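/-
Origin: expansion seat `planner-pub-hodgecm-pv14-g6-0`, handover import Pv14g6.SchwartzHyperbolicFlow -> import HodgeCM.Automorphic.SchwartzHyperbolicFlow ; after t31 row 10 (SchwartzHyperbolicFlow) (`HOME/pub-hodgecm-pv14-g6/lean/Pv14g6/SchwartzHyperbolicFlowCoord.lean`, md5 3ef02241, 162 lines);
landed by the gen-8 packager in gate run 31 as `HodgeCM/Automorphic/SchwartzHyperbolicFlowCoord.lean` (import ^import Pv14g6\.SchwartzHyperbolicFlow[ \t]*$→import HodgeCM.Automorphic.SchwartzHyperbolicFlow ×1).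
-/
/-
Copyright: HodgeCM public adjudication package, seat pub-hodgecm-pv14-g6 (DAG-NODE PROVER #14, gen 6).
File #26 of this seat.  Kernel-checked, no new axioms.  Imports file #25 of this seat and Mathlib only.
-/
import Summits.HodgeConjecture.HodgeCM.Automorphic.SchwartzHyperbolicFlow

/-!
# The hyperbolic rotation flow in coordinates `(ι ⊕ ι) → ℝ`

File #25 builds the one-parameter group `exp(sJ) = cosh s · 1 + sinh s · J` for any continuous linear
`J` with `J² = 1` and proves its Schwartz-topology differentiability.  The polynomial / Bargmann side
of this package works on the coordinate space `(ι ⊕ ι) → ℝ` (`ι` a finite index type; "mixed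
variables" `x_a`, `y_a`), where the hyperbolic generator is the **swap-and-negate** map
`(J v)(k) = -v(swap k)`, i.e. `x_a ↦ -y_a`, `y_a ↦ -x_a`, and the flow is
`x_a ↦ cosh s · x_a - sinh s · y_a`, `y_a ↦ cosh s · y_a - sinh s · x_a`.  This file is that
instantiation:

* `swapNegCLM ι` and `swapNegCLM_apply`, `swapNegCLM_mul_self : J * J = 1`;
* `coordHypFlow ι s := involFlow (swapNegCLM ι) _ s` with the coordinate formulas
  `coordHypFlow_apply_inl`, `coordHypFlow_apply_inr`, the group law and `coordHypFlow_zero_apply`;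
* `flowGen_swapNegCLM_apply : flowGen J Φ v = DΦ(v)[k ↦ -v(swap k)]`;
* on `𝓢((ι ⊕ ι) → ℝ, F)`: `tendsto_compCLM_coordHypFlow_sub_div_at` (real scalars, every base
  point), `contDiff_apply_compCLM_coordHypFlow`, and for complex targets
  `tendsto_compCLM_coordHypFlow_sub_div_ofReal` —
  `((s : ℂ))⁻¹ • (Φ ∘ coordHypFlow s - Φ) → flowGen J Φ`, `s → 0`, `s ≠ 0`.

Only published mathematics is used (Mathlib); nothing here refers to the objects under adjudication.
-/

noncomputable section

open Filter Topology
open scoped SchwartzMap ContDiff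

namespace HodgeCM
namespace SchwartzWeil

section Coord

variable (ι : Type*)

/-- The swap-and-negate generator on `(ι ⊕ ι) → ℝ`: `(J v)(k) = -v(swap k)`. -/
def swapNegCLM : ((ι ⊕ ι) → ℝ) →L[ℝ] ((ι ⊕ ι) → ℝ) :=
  -(ContinuousLinearMap.pi fun k => ContinuousLinearMap.proj (R := ℝ) (φ := fun _ : ι ⊕ ι => ℝ)
    (Sum.swap k))

/-- (Ported verbatim from the HodgeCMPerL package; no docstring in the source.) -/
@[simp] theorem swapNegCLM_apply (v : (ι ⊕ ι) → ℝ) (k : ι ⊕ ι) :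
    swapNegCLM ι v k = -v (Sum.swap k) := by
  simp [swapNegCLM]

/-- `J² = 1`. -/
theorem swapNegCLM_mul_self : swapNegCLM ι * swapNegCLM ι = 1 := by
  ext v k
  simp

variable [Fintype ι]

/-- The hyperbolic rotation flow in coordinates. -/
def coordHypFlow (s : ℝ) : ((ι ⊕ ι) → ℝ) ≃L[ℝ] ((ι ⊕ ι) → ℝ) :=
  involFlow (swapNegCLM ι) (swapNegCLM_mul_self ι) s

/-- (Ported verbatim from the HodgeCMPerL package; no docstring in the source.) -/
theorem coordHypFlow_apply (s : ℝ) (v : (ι ⊕ ι) → ℝ) (k : ι ⊕ ι) :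
    coordHypFlow ι s v k = Real.cosh s * v k - Real.sinh s * v (Sum.swap k) := by
  simp [coordHypFlow, sub_eq_add_neg]

/-- `x_a ↦ cosh s · x_a - sinh s · y_a`. -/
@[simp] theorem coordHypFlow_apply_inl (s : ℝ) (v : (ι ⊕ ι) → ℝ) (a : ι) :
    coordHypFlow ι s v (Sum.inl a) = Real.cosh s * v (Sum.inl a) - Real.sinh s * v (Sum.inr a) :=
  coordHypFlow_apply ι s v (Sum.inl a)

/-- `y_a ↦ cosh s · y_a - sinh s · x_a`. -/
@[simp] theorem coordHypFlow_apply_inr (s : ℝ) (v : (ι ⊕ ι) → ℝ) (a : ι) :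
    coordHypFlow ι s v (Sum.inr a) = Real.cosh s * v (Sum.inr a) - Real.sinh s * v (Sum.inl a) :=
  coordHypFlow_apply ι s v (Sum.inr a)

/-- (Ported verbatim from the HodgeCMPerL package; no docstring in the source.) -/
theorem coordHypFlow_zero_apply (v : (ι ⊕ ι) → ℝ) : coordHypFlow ι 0 v = v := by
  ext k
  simp [coordHypFlow_apply]

/-- (Ported verbatim from the HodgeCMPerL package; no docstring in the source.) -/
theorem coordHypFlow_add_apply (s t : ℝ) (v : (ι ⊕ ι) → ℝ) :
    coordHypFlow ι (s + t) v = coordHypFlow ι s (coordHypFlow ι t v) :=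
  involFlow_add_apply (swapNegCLM ι) (swapNegCLM_mul_self ι) s t v

/-- (Ported verbatim from the HodgeCMPerL package; no docstring in the source.) -/
theorem coe_coordHypFlow_zero :
    ((coordHypFlow ι 0 : ((ι ⊕ ι) → ℝ) ≃L[ℝ] ((ι ⊕ ι) → ℝ)) : ((ι ⊕ ι) → ℝ) →L[ℝ] ((ι ⊕ ι) → ℝ)) = 1 :=
  coe_involFlow_zero (swapNegCLM ι) (swapNegCLM_mul_self ι)

/-- The operator-norm derivative of the coordinate flow at `0` is the swap-and-negate map. -/
theorem hasDerivAt_coe_coordHypFlow :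
    HasDerivAt (fun s => ((coordHypFlow ι s : ((ι ⊕ ι) → ℝ) ≃L[ℝ] ((ι ⊕ ι) → ℝ)) :
      ((ι ⊕ ι) → ℝ) →L[ℝ] ((ι ⊕ ι) → ℝ))) (swapNegCLM ι) 0 :=
  hasDerivAt_coe_involFlow (swapNegCLM ι) (swapNegCLM_mul_self ι)

/-- The velocity at `s = 0` in coordinates: `d/ds (coordHypFlow s v k)|₀ = -v(swap k)`. -/
theorem hasDerivAt_coordHypFlow_apply (v : (ι ⊕ ι) → ℝ) (k : ι ⊕ ι) :
    HasDerivAt (fun s : ℝ => coordHypFlow ι s v k) (-v (Sum.swap k)) 0 := by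
  have h := ((Real.hasDerivAt_cosh 0).mul_const (v k)).sub ((Real.hasDerivAt_sinh 0).mul_const
    (v (Sum.swap k)))
  rw [Real.sinh_zero, Real.cosh_zero, zero_mul, one_mul, zero_sub] at h
  exact h.congr_of_eventuallyEq (Eventually.of_forall fun s => coordHypFlow_apply ι s v k)

variable {ι}
variable {F G : Type*} [NormedAddCommGroup F] [NormedSpace ℝ F] [NormedAddCommGroup G] [NormedSpace ℝ G]

/-- The generator on Schwartz space in coordinates: `flowGen J Φ v = DΦ(v)[k ↦ -v(swap k)]`. -/
theorem flowGen_swapNegCLM_apply (Φ : 𝓢((ι ⊕ ι) → ℝ, F)) (v : (ι ⊕ ι) → ℝ) :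
    flowGen (swapNegCLM ι) Φ v = fderiv ℝ (Φ : ((ι ⊕ ι) → ℝ) → F) v (fun k => -v (Sum.swap k)) := by
  rw [flowGen_apply]
  exact congrArg (fderiv ℝ (Φ : ((ι ⊕ ι) → ℝ) → F) v) (funext fun k => swapNegCLM_apply ι v k)

variable (𝕜 : Type*) [RCLike 𝕜] [NormedSpace 𝕜 F] [SMulCommClass ℝ 𝕜 F]

/-- **The coordinate flow is differentiable in the Schwartz topology, at every base point.** -/
theorem tendsto_compCLM_coordHypFlow_sub_div_at (Φ : 𝓢((ι ⊕ ι) → ℝ, F)) (s₀ : ℝ) :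
    Tendsto (fun s : ℝ => s⁻¹ • (SchwartzMap.compCLMOfContinuousLinearEquiv 𝕜 (coordHypFlow ι (s₀ + s)) Φ
        - SchwartzMap.compCLMOfContinuousLinearEquiv 𝕜 (coordHypFlow ι s₀) Φ)) (𝓝[≠] 0)
      (𝓝 (flowGen (swapNegCLM ι) (SchwartzMap.compCLMOfContinuousLinearEquiv 𝕜 (coordHypFlow ι s₀) Φ))) :=
  tendsto_compCLM_involFlow_sub_div_at 𝕜 (swapNegCLM ι) (swapNegCLM_mul_self ι) Φ s₀

/-- Every scalar coefficient `s ↦ T (Φ ∘ coordHypFlow s)` is `C^∞` on `ℝ`. -/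
theorem contDiff_apply_compCLM_coordHypFlow (T : 𝓢((ι ⊕ ι) → ℝ, F) →L[ℝ] G)
    (Φ : 𝓢((ι ⊕ ι) → ℝ, F)) :
    ContDiff ℝ ∞ (fun s : ℝ => T (SchwartzMap.compCLMOfContinuousLinearEquiv 𝕜 (coordHypFlow ι s) Φ)) :=
  contDiff_apply_compCLM_involFlow 𝕜 (swapNegCLM ι) (swapNegCLM_mul_self ι) T Φ

/-- With derivative `T (flowGen J (Φ ∘ coordHypFlow s₀))` at every `s₀`. -/
theorem hasDerivAt_apply_compCLM_coordHypFlow (T : 𝓢((ι ⊕ ι) → ℝ, F) →L[ℝ] G)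
    (Φ : 𝓢((ι ⊕ ι) → ℝ, F)) (s₀ : ℝ) :
    HasDerivAt (fun s => T (SchwartzMap.compCLMOfContinuousLinearEquiv 𝕜 (coordHypFlow ι s) Φ))
      (T (flowGen (swapNegCLM ι) (SchwartzMap.compCLMOfContinuousLinearEquiv 𝕜 (coordHypFlow ι s₀) Φ)))
      s₀ :=
  hasDerivAt_apply_compCLM_involFlow 𝕜 (swapNegCLM ι) (swapNegCLM_mul_self ι) T Φ s₀

end Coord

section CoordComplex

variable {ι : Type*} [Fintype ι]
variable {F : Type*} [NormedAddCommGroup F] [NormedSpace ℝ F] [NormedSpace ℂ F] [IsScalarTower ℝ ℂ F]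
  [SMulCommClass ℝ ℂ F]

/-- **The coordinate hyperbolic flow with complex scalars at `0`** (the literal smooth-vector-clause
shape): `((s : ℂ))⁻¹ • (Φ ∘ coordHypFlow s - Φ) → flowGen J Φ` in `𝓢((ι ⊕ ι) → ℝ, F)`. -/
theorem tendsto_compCLM_coordHypFlow_sub_div_ofReal (Φ : 𝓢((ι ⊕ ι) → ℝ, F)) :
    Tendsto (fun s : ℝ => ((s : ℂ))⁻¹
        • (SchwartzMap.compCLMOfContinuousLinearEquiv ℂ (coordHypFlow ι s) Φ - Φ)) (𝓝[≠] 0)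
      (𝓝 (flowGen (swapNegCLM ι) Φ)) :=
  tendsto_compCLM_involFlow_sub_div_ofReal (swapNegCLM ι) (swapNegCLM_mul_self ι) Φ

/-- The same at every base point. -/
theorem tendsto_compCLM_coordHypFlow_sub_div_ofReal_at (Φ : 𝓢((ι ⊕ ι) → ℝ, F)) (s₀ : ℝ) :
    Tendsto (fun s : ℝ => ((s : ℂ))⁻¹
        • (SchwartzMap.compCLMOfContinuousLinearEquiv ℂ (coordHypFlow ι (s₀ + s)) Φ
          - SchwartzMap.compCLMOfContinuousLinearEquiv ℂ (coordHypFlow ι s₀) Φ)) (𝓝[≠] 0)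
      (𝓝 (flowGen (swapNegCLM ι)
        (SchwartzMap.compCLMOfContinuousLinearEquiv ℂ (coordHypFlow ι s₀) Φ))) :=
  tendsto_compCLM_involFlow_sub_div_ofReal_at (swapNegCLM ι) (swapNegCLM_mul_self ι) Φ s₀

end CoordComplex

end SchwartzWeil
end HodgeCM
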